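import Literature.NumberTheory.Automorphic.ArchInnerFormChartOrbLocal         -- ★ G2 (LH3-p03 (g3)): `chartOrbGLoc`, `chartHaarGLoc`, `chartOrbGLoc_eq_of_isHaarMeasure`; brings ★ G1 `gprimeBlockAt`, `chartTorusGLoc`, `chartBoxImgGLoc`
import Literature.NumberTheory.Automorphic.ArchEndoscopicChartOrbLocalCongr   -- ★ (LH10-p02 (g4)) (T-CONGR): generic `toReal_mul_integral_descConj_quotientMeasure_eq_of_eq`, `chartBoxLoc_eq_of_mem_iff`
import HarnessLib

/-!
# The local `G′` chart orbital functional `chartOrbGLoc L α w S′` depends on the label `S′` only through `w ∈ S′`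
# ((PROD-QUOT-G′) companion of FILE G2 — the `G′`-side twin of ★ `ArchEndoscopicChartOrbLocalCongr`: Rogawski 1990 §3.6, §8.2; Shelstad 1979 §4; Deitmar–Echterhoff 2014 Thm. 1.5.3)

Topic `NumberTheory/Automorphic`; namespace `Literature.NumberTheory.Automorphic.UnitaryGroup`.  THEOREMS ONLY (no `def`, no instance, no notation, no axiom, no `sorry`).
Cell `pub/hodgecm-mathlib`, crux H413 (`stmt-HodgeConjecture-24833`), line LH3 (closer stub `stub_N9`, DIRECT ROAD), organ J ((J-G′) docking); count-neutral.
On the `G′` side of organ J the jump of `orbFamG(Ext) L α ν′ a′ S′` at the covered wall `w₀ ∉ S′` of a PRODUCT `a′` reads (★ (G3) `chartOrbG_eq_prod_chartOrbGLoc`) as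
«spectator factors `Π_{w ≠ w₀} chartOrbGLoc L α w S′ …` × jump of the `w₀`-factor», while the value on the adjacent chart `insert w₀ S′` reads the spectators
`chartOrbGLoc L α w (insert w₀ S′) …`; the ratio `jc′` is uniform only because these spectators COINCIDE: the local `G′` data at `w` (★ `gprimeBlock` — one `dite` on
`w ∈ S′ ∧ w ∈ splitChartPlaces` —, hence `gprimeBlockAt`, `chartTorusGLoc`, the local box ★ `chartBoxLoc`) read `S′` only through `w ∈ S′`, and the auxiliary Haar measures of the
(equal) local tori are absorbed by ★ Haar-freeness + the generic rigidity lemma of ★ (T-CONGR).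
* §1 `gprimeBlock_eq_of_mem_iff`, `gprimeBlockAt_eq_of_mem_iff`, `chartTorusGLoc_eq_of_mem_iff`;
* §2 **`chartOrbGLoc_eq_of_mem_iff : (w ∈ S′ ↔ w ∈ S″) → chartOrbGLoc L α w S′ ν_w f cw = chartOrbGLoc L α w S″ ν_w f cw`**, `chartOrbGLoc_insert_of_ne`, `chartOrbGLoc_erase_of_ne`.
HONEST LABEL: HC_CM is proved only modulo the 7 printed citations (2 remaining: hLiu418 = `stmt-HodgeConjecture-24832`, h413 = `stmt-HodgeConjecture-24833`) until rung 0
closes; measure-theoretic bookkeeping, moves no row of the books.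

## References
* [Rogawski1990] J. D. Rogawski, *Automorphic Representations of Unitary Groups in Three Variables*, Ann. of Math. Stud. 123 (1990), §3.6 p. 31, §8.2 p. 122, §8.3 p. 124.
* [Shelstad1979] D. Shelstad, *Characters and inner forms of a quasi-split group over ℝ*, Compositio Math. 39 (1979), §4 pp. 22–23.
* [DeitmarEchterhoff2014] A. Deitmar, S. Echterhoff, *Principles of Harmonic Analysis*, 2nd ed. (2014), Thm. 1.5.3, Cor. 1.5.4.
* [Folland1995] G. B. Folland, *A Course in Abstract Harmonic Analysis* (1995), §2.2, §2.6 (2.52).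
-/

set_option autoImplicit false

noncomputable section

open MeasureTheory MeasureTheory.Measure NumberField NumberField.InfinitePlace Matrix Complex Topology
open Literature.MeasureTheory.Group
open scoped MatrixGroups Matrix Classical ENNReal NNReal

namespace Literature.NumberTheory.Automorphic.UnitaryGroup

/-! ## §1 The local `G′` data read `S′` only through `w ∈ S′` -/

section LocalData

variable (L : Type) [Field L] (α : Fin 3 → L) (w : {w : InfinitePlace L // IsComplex w}) {S' S'' : Finset {w : InfinitePlace L // IsComplex w}}

/-- ★ `gprimeBlock L α w S′ c` reads `S′` only through `w ∈ S′` (one `dite` on `w ∈ S′ ∧ w ∈ splitChartPlaces`). [cite: Rogawski1990, §3.6 p. 31] -/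
theorem gprimeBlock_eq_of_mem_iff (h : w ∈ S' ↔ w ∈ S'') (c : {w : InfinitePlace L // IsComplex w} → Fin 3 → ℝ) :
    gprimeBlock L α w S' c = gprimeBlock L α w S'' c := by
  unfold gprimeBlock
  by_cases hw : w ∈ S' ∧ w ∈ splitChartPlaces L α
  · rw [dif_pos hw, dif_pos ⟨h.1 hw.1, hw.2⟩]
  · have hw' : ¬ (w ∈ S'' ∧ w ∈ splitChartPlaces L α) := fun h' => hw ⟨h.2 h'.1, h'.2⟩
    rw [dif_neg hw, dif_neg hw']

/-- The local chart `gprimeBlockAt L α w S′` reads `S′` only through `w ∈ S′`. [cite: Rogawski1990, §3.6 p. 31] -/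
theorem gprimeBlockAt_eq_of_mem_iff (h : w ∈ S' ↔ w ∈ S'') : gprimeBlockAt L α w S' = gprimeBlockAt L α w S'' :=
  funext fun cw => gprimeBlock_eq_of_mem_iff L α w h (fun _ => cw)

variable [NumberField L] [IsCMField L]

/-- The local `G′` torus `T′_{S′,w}` reads `S′` only through `w ∈ S′`. [cite: Shelstad1979, §4 p. 22] [cite: Rogawski1990, §3.6 p. 31] -/
theorem chartTorusGLoc_eq_of_mem_iff (h : w ∈ S' ↔ w ∈ S'') : chartTorusGLoc L α w S' = chartTorusGLoc L α w S'' := by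
  have hr : (gprimeBlockAtHom L α w S').range = (gprimeBlockAtHom L α w S'').range := by
    ext g
    simp only [MonoidHom.mem_range, gprimeBlockAtHom_apply, gprimeBlockAt_eq_of_mem_iff L α w h]
  unfold chartTorusGLoc
  rw [hr]

end LocalData

/-! ## §2 The head -/

section Head

variable (L : Type) [Field L] [NumberField L] [IsCMField L] (α : Fin 3 → L) (w : {w : InfinitePlace L // IsComplex w}) {S' S'' : Finset {w : InfinitePlace L // IsComplex w}}
  [MeasurableSpace ↥(archLocal L 3 (Matrix.diagonal α) w)] [BorelSpace ↥(archLocal L 3 (Matrix.diagonal α) w)]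
  (νw : Measure ↥(archLocal L 3 (Matrix.diagonal α) w)) [νw.IsHaarMeasure] [νw.IsMulRightInvariant]

/-- **THE LOCAL `G′` FUNCTIONAL READS THE LABEL `S′` ONLY THROUGH `w ∈ S′`**: if `w ∈ S′ ↔ w ∈ S″` then `chartOrbGLoc L α w S′ ν_w f cw = chartOrbGLoc L α w S″ ν_w f cw` for every
`f`, `cw` (no measurability, no frame hypothesis) — local chart, torus and box coincide (§1, ★ `chartBoxLoc_eq_of_mem_iff`), the auxiliary Haar measures are absorbed by ★ Haar-freeness
and the rigidity lemma ★ `toReal_mul_integral_descConj_quotientMeasure_eq_of_eq`. [cite: Rogawski1990, §8.2 p. 122; §8.3 p. 124] [cite: Shelstad1979, §4 pp. 22–23]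
[cite: DeitmarEchterhoff2014, Thm. 1.5.3] [cite: Folland1995, §2.6 (2.52)] -/
theorem chartOrbGLoc_eq_of_mem_iff (h : w ∈ S' ↔ w ∈ S'') (f : ↥(archLocal L 3 (Matrix.diagonal α) w) → ℂ) (cw : Fin 3 → ℝ) :
    chartOrbGLoc L α w S' νw f cw = chartOrbGLoc L α w S'' νw f cw := by
  haveI := locallyCompactSpace_archLocal_three L α w
  haveI := secondCountableTopology_archLocal_three L α w
  haveI := locallyCompactSpace_chartTorusGLoc L α w S'
  haveI := locallyCompactSpace_chartTorusGLoc L α w S''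
  haveI := isHaarMeasure_chartHaarGLoc L α w S'
  haveI := isInvInvariant_chartHaarGLoc L α w S'
  haveI := isHaarMeasure_chartHaarGLoc L α w S''
  haveI := isInvInvariant_chartHaarGLoc L α w S''
  rw [chartOrbGLoc_eq_of_isHaarMeasure L α w S' νw (chartHaarGLoc L α w S') f cw,
    chartOrbGLoc_eq_of_isHaarMeasure L α w S'' νw (chartHaarGLoc L α w S'') f cw]
  exact toReal_mul_integral_descConj_quotientMeasure_eq_of_eq νw (gprimeBlockAt_eq_of_mem_iff L α w h) (chartBoxLoc_eq_of_mem_iff L w h)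
    (chartTorusGLoc_eq_of_mem_iff L α w h) (isClosed_chartTorusGLoc L α w S') (isClosed_chartTorusGLoc L α w S'')
    (gprimeBlockAt_mem_chartTorusGLoc L α w S') (gprimeBlockAt_mem_chartTorusGLoc L α w S'')
    (congrFun (gprimeBlockAt_eq_of_mem_iff L α w h) cw) (forall_mem_chartTorusGLoc_comm L α w S' cw) (forall_mem_chartTorusGLoc_comm L α w S'' cw) f
    (chartHaarGLoc L α w S') (chartHaarGLoc L α w S'')

/-- **The `G′` spectator functionals of `S′` and `insert w₀ S′` agree at every `w ≠ w₀`.** [cite: Rogawski1990, §8.2 p. 122] [cite: Shelstad1979, §4 pp. 22–23] -/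
theorem chartOrbGLoc_insert_of_ne {w₀ : {w : InfinitePlace L // IsComplex w}} (hne : w ≠ w₀) (S' : Finset {w : InfinitePlace L // IsComplex w})
    (f : ↥(archLocal L 3 (Matrix.diagonal α) w) → ℂ) (cw : Fin 3 → ℝ) :
    chartOrbGLoc L α w (insert w₀ S') νw f cw = chartOrbGLoc L α w S' νw f cw :=
  chartOrbGLoc_eq_of_mem_iff L α w νw (by rw [Finset.mem_insert, or_iff_right hne]) f cw

/-- **The `G′` spectator functionals of `S′` and `S′.erase w₀` agree at every `w ≠ w₀`.** [cite: Rogawski1990, §8.2 p. 122] [cite: Shelstad1979, §4 pp. 22–23] -/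
theorem chartOrbGLoc_erase_of_ne {w₀ : {w : InfinitePlace L // IsComplex w}} (hne : w ≠ w₀) (S' : Finset {w : InfinitePlace L // IsComplex w})
    (f : ↥(archLocal L 3 (Matrix.diagonal α) w) → ℂ) (cw : Fin 3 → ℝ) :
    chartOrbGLoc L α w (S'.erase w₀) νw f cw = chartOrbGLoc L α w S' νw f cw :=
  chartOrbGLoc_eq_of_mem_iff L α w νw (by rw [Finset.mem_erase, and_iff_right hne]) f cw

end Head

end Literature.NumberTheory.Automorphic.UnitaryGroup

end
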